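import Summits.ResolutionOfSingularities.ResolutionOfSingularities.Theorems.EquisingularLiftEquisingularLiftNatUltFlat
import HarnessLib

/-!
# [OURS · L1 W4.5(b)] `EquisingularLift.ULTFlatAt` / `EquisingularLift.ULTFlat` — ULT WITH FLATNESS, the typed target of the
# K5-BMY disprover hand (stmt-ResolutionOfSingularities-20038 AS TYPED @ `n = 5`), and its wiring to the item

Everything here is OURS (cell res-hironaka, crux chain w45b, slot W4.5(b)); NOT a statement of any manuscript; replaces the role
of NOTHING in the manuscript; AI-written, AI review is weaker than expert review. `--supports stmt-ResolutionOfSingularities-20038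
--as helper`. Asked for by the K5-BMY hand res-D-brk-4 (STATUS 2026-08-27T07:39:02Z: «the K5-BMY skeleton will target
`¬ ULTFlatAt p k 5 H ι η_S` (your decl name governs)»); director-resolution RULING 06:57:05Z (1)/(4).

* `ULTFlatAt p k n H ι h` — res-L1-type-o1's `ULTAt p k n H ι h` (`…CampaignW45bULT.lean`, byte-for-byte) with TWO clauses
  inserted and nothing else changed: in the `x`-avoiding step hypothesis, after `IsRegular C.subscheme →`, the clause
  `Flat (C.subschemeι ≫ σ′ ≫ q) →` (the avoiding prefix is HORIZONTAL); in the centre clause, after `IsRegular C.subscheme ∧`,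
  the clause `Flat (C.subschemeι ≫ σ ≫ q) ∧` (the touching centre is GLOBALLY `O`-FLAT). Here `q = Proj.toSpecZero _ ≫
  Spec.map (algebraMap O (O[x])₀)` is the structure morphism of `ℙⁿ_O`, spelled as in the item.
* `ULTFlat p` — binders of `ULT p` MINUS the unused «`¬ IsClosed {h}`» (binder (B) of `ULT` is not needed by the implication; a
  disprover instantiates `h := η_S` anyway), conclusion `ULTFlatAt p k n H ι h`.
* `ultFlat_iff` (`Iff.rfl` against the inline text proved in `…NatUltFlat.lean`), `ultFlat_of_equisingularLiftNat :
  EquisingularLiftNat p → ULTFlat p` (= `Sections.ultFlat_of_equisingularLiftNat` of `…NatUltFlat.lean`),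
  `not_equisingularLiftNat_of_not_ultFlatAt` (THE DISPROVER'S EXIT: one instance with `¬ ULTFlatAt` refutes the item at `p`),
  `ultAt_of_ultFlatAt` (pure logic: the flat form implies o1's `ULTAt` — the closure under MORE step hypotheses is implied by the
  closure under fewer, and the extra conjunct is dropped).

VACUITY / STRENGTH: `ULTFlatAt` is implied by the item at every non-regular `h` and holds outright whenever `closure {x}` has an
embedded regular `O`-flat E1 lift at level 0 (empty chain), so it is neither vacuous nor trivially false; it is strictly more
informative than `ULTAt` for a refuter (flat prefix, flat centre). Hypotheses satisfiable (every integral hypersurface).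
References: `…CampaignW45bULT.lean` (o1), `…NatUltOfNat.lean` (p505870), `…NatUltFlat.lean`, `…NatHorizontalForced.lean`
(p509967); HOME/D/res-D-brk-4/K5-BMY/SKELETON-v1.md 0eb8d02cb1baa978 (the consumer).
-/

noncomputable section

set_option linter.dupNamespace false -- mandated namespace of this single-conjunct summit

namespace Summit.ResolutionOfSingularities.ResolutionOfSingularities.Theorems

namespace EquisingularLift

/-- [OURS · L1 W4.5(b)] replaces the role of NOTHING in the manuscript; NOT a statement of the manuscript. **ULT WITH FLATNESS AT ONE
INSTANCE `(k, n, H, ι)` AND ONE POINT `h` OF `H`**: o1's `ULTAt p k n H ι h` byte-for-byte with the two flatness clauses inserted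
(avoiding steps `Flat (C.subschemeι ≫ σ′ ≫ q)`, touching centre `Flat (C.subschemeι ≫ σ ≫ q)`): there are a characteristic-0 DVR
`O` with a surjection `π : O → k` such that for every graded `φ` inducing `MvPolynomial.map π` and `Y = range (ι ≫ Proj.map φ)`,
writing `x := (ι ≫ Proj.map φ) h`, some `(P′, σ, S′)` lies in the inductive closure of `(ℙⁿ_O, 𝟙, Y)` under E1 blow-up steps
with regular `O`-FLAT centres over non-generic points of `Y` AVOIDING `x`, and carries an ideal sheaf `C` with `V(C)` regular and
`O`-FLAT, a point `x′ ∈ supp C` over `x` with a generisation `c ∈ supp C` off the special fibre, `supp C ∩` special fibre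
`⊆ closure S′` (E1), `σ(supp C)` off the generic points of `Y`. The K5-BMY disprover target is `¬ ULTFlatAt p k 5 H ι η_S`.
[folklore] -/
def ULTFlatAt (p : ℕ) (k : Type) [Field k] [CharP k p] [IsAlgClosed k] (n : ℕ) (H : AlgebraicGeometry.Scheme.{0})
    (ι : H ⟶ (Literature.AlgebraicGeometry.Motives.projectiveSpace n k).left) (h : H) : Prop :=
  ∃ (O : Type) (_ : CommRing O) (_ : IsDomain O) (_ : IsDiscreteValuationRing O) (_ : CharZero O) (π : O →+* k), Function.Surjective π ∧ (letI := MvPolynomial.gradedAlgebra (σ := Fin (n + 1)) (R := O); letI := MvPolynomial.gradedAlgebra (σ := Fin (n + 1)) (R := k); ∀ (φ : MvPolynomial.homogeneousSubmodule (Fin (n + 1)) O →+*ᵍ MvPolynomial.homogeneousSubmodule (Fin (n + 1)) k) (hφ' : HomogeneousIdeal.irrelevant (MvPolynomial.homogeneousSubmodule (Fin (n + 1)) k) ≤ (HomogeneousIdeal.irrelevant (MvPolynomial.homogeneousSubmodule (Fin (n + 1)) O)).map φ), (∀ s, φ s = MvPolynomial.map π s) → ∀ Y : Set (AlgebraicGeometry.Proj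 (MvPolynomial.homogeneousSubmodule (Fin (n + 1)) O)), Y = Set.range (CategoryTheory.CategoryStruct.comp ι (AlgebraicGeometry.Proj.map φ hφ') : H ⟶ (AlgebraicGeometry.Proj (MvPolynomial.homogeneousSubmodule (Fin (n + 1)) O))) → ∃ (P' : AlgebraicGeometry.Scheme.{0}) (σ : P' ⟶ (AlgebraicGeometry.Proj (MvPolynomial.homogeneousSubmodule (Fin (n + 1)) O))) (S' : Set P'), (∀ Q : (∀ X' : AlgebraicGeometry.Scheme.{0}, (X' ⟶ (AlgebraicGeometry.Proj (MvPolynomial.homogeneousSubmodule (Fin (n + 1)) O))) → Set X' → Prop), Q (AlgebraicGeometry.Proj (MvPolynomial.homogeneousSubmodule (Fin (n + 1)) O)) (CategoryTheory.CategoryStruct.id _) Y → (∀ (X' X'' : AlgebraicGeometry.Scheme.{0}) (σ' : X' ⟶ (AlgebraicGeometry.Proj (MvPolynomial.homogeneousSubmodule (Fin (n + 1)) O))) (Y' : Set X') (C : X'.IdealSheafData) (τ : X'' ⟶ X'), Q X' σ' Y' → Literature.AlgebraicGeometry.Resolution.IsBlowup τ C → Literature.AlgebraicGeometry.Resolution.Scheme.IsRegular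 C.subscheme → AlgebraicGeometry.Flat (CategoryTheory.CategoryStruct.comp C.subschemeι (CategoryTheory.CategoryStruct.comp σ' (CategoryTheory.CategoryStruct.comp (AlgebraicGeometry.Proj.toSpecZero (MvPolynomial.homogeneousSubmodule (Fin (n + 1)) O)) (AlgebraicGeometry.Spec.map (CommRingCat.ofHom (algebraMap O (MvPolynomial.homogeneousSubmodule (Fin (n + 1)) O 0))))))) → σ' '' (C.support : Set X') ⊆ {x | ¬ IsGenericPoint x Y} → (C.support : Set X') ∩ (CategoryTheory.CategoryStruct.comp σ' (CategoryTheory.CategoryStruct.comp (AlgebraicGeometry.Proj.toSpecZero (MvPolynomial.homogeneousSubmodule (Fin (n + 1)) O)) (AlgebraicGeometry.Spec.map (CommRingCat.ofHom (algebraMap O (MvPolynomial.homogeneousSubmodule (Fin (n + 1)) O 0)))))) ⁻¹' {IsLocalRing.closedPoint O} ⊆ Y' → ((CategoryTheory.CategoryStruct.comp ι (AlgebraicGeometry.Proj.map φ hφ') : H ⟶ (AlgebraicGeometry.Proj (MvPolynomial.homogeneousSubmodule (Fin (n + 1)) O))) h) ∉ σ' '' (C.support : Set X') → Q X'' (CategoryTheory.CategoryStruct.comp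 τ σ') (closure (τ ⁻¹' (Y' \ (C.support : Set X'))))) → Q P' σ S') ∧ ∃ C : P'.IdealSheafData, Literature.AlgebraicGeometry.Resolution.Scheme.IsRegular C.subscheme ∧ AlgebraicGeometry.Flat (CategoryTheory.CategoryStruct.comp C.subschemeι (CategoryTheory.CategoryStruct.comp σ (CategoryTheory.CategoryStruct.comp (AlgebraicGeometry.Proj.toSpecZero (MvPolynomial.homogeneousSubmodule (Fin (n + 1)) O)) (AlgebraicGeometry.Spec.map (CommRingCat.ofHom (algebraMap O (MvPolynomial.homogeneousSubmodule (Fin (n + 1)) O 0))))))) ∧ (∃ x' : P', x' ∈ (C.support : Set P') ∧ σ x' = ((CategoryTheory.CategoryStruct.comp ι (AlgebraicGeometry.Proj.map φ hφ') : H ⟶ (AlgebraicGeometry.Proj (MvPolynomial.homogeneousSubmodule (Fin (n + 1)) O))) h) ∧ ∃ c : P', c ∈ (C.support : Set P') ∧ c ∉ (CategoryTheory.CategoryStruct.comp σ (CategoryTheory.CategoryStruct.comp (AlgebraicGeometry.Proj.toSpecZero (MvPolynomial.homogeneousSubmodule (Fin (n + 1)) O)) (AlgebraicGeometry.Spec.map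 (CommRingCat.ofHom (algebraMap O (MvPolynomial.homogeneousSubmodule (Fin (n + 1)) O 0)))))) ⁻¹' {IsLocalRing.closedPoint O} ∧ c ⤳ x') ∧ (C.support : Set P') ∩ (CategoryTheory.CategoryStruct.comp σ (CategoryTheory.CategoryStruct.comp (AlgebraicGeometry.Proj.toSpecZero (MvPolynomial.homogeneousSubmodule (Fin (n + 1)) O)) (AlgebraicGeometry.Spec.map (CommRingCat.ofHom (algebraMap O (MvPolynomial.homogeneousSubmodule (Fin (n + 1)) O 0)))))) ⁻¹' {IsLocalRing.closedPoint O} ⊆ closure S' ∧ σ '' (C.support : Set P') ⊆ {x | ¬ IsGenericPoint x Y})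

/-- [OURS · L1 W4.5(b)] replaces the role of NOTHING in the manuscript; NOT a statement of the manuscript. **ULT WITH FLATNESS —
the necessary condition of `EquisingularLiftNat p` in the flat currency**: for prime `p`, every algebraically closed `k` of
characteristic `p`, every `n`, every integral closed `H ⊆ ℙⁿ_k` with locally principal ideal (the item's binders verbatim) and
every point `h` of `H` whose local ring is not regular: `ULTFlatAt p k n H ι h`. (Binders of o1's `ULT p` minus the unused
«`h` not closed».) [folklore] -/
def ULTFlat (p : ℕ) : Prop :=
  p.Prime → ∀ (k : Type) [Field k] [CharP k p] [IsAlgClosed k] (n : ℕ) (H : AlgebraicGeometry.Scheme.{0}) (ι : H ⟶ (Literature.AlgebraicGeometry.Motives.projectiveSpace n k).left), AlgebraicGeometry.IsClosedImmersion ι → AlgebraicGeometry.IsIntegral H → (∀ y : (Literature.AlgebraicGeometry.Motives.projectiveSpace n k).left, ∃ U : (Literature.AlgebraicGeometry.Motives.projectiveSpace n k).left.affineOpens, y ∈ (U : (Literature.AlgebraicGeometry.Motives.projectiveSpace n k).left.Opens) ∧ (ι.ker.ideal U).IsPrincipal) → ∀ (h : H), ¬ IsRegularLocalRing (H.presheaf.stalk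 h) → ULTFlatAt p k n H ι h

/-! ## Wiring -/

/-- Pure logic: `ULTFlat p` unfolds to the inline statement proved in `…NatUltFlat.lean` (`Iff.rfl`). [folklore] -/
theorem ultFlat_iff (p : ℕ) : ULTFlat p ↔ (p.Prime → ∀ (k : Type) [Field k] [CharP k p] [IsAlgClosed k] (n : ℕ) (H : AlgebraicGeometry.Scheme.{0}) (ι : H ⟶ (Literature.AlgebraicGeometry.Motives.projectiveSpace n k).left), AlgebraicGeometry.IsClosedImmersion ι → AlgebraicGeometry.IsIntegral H → (∀ y : (Literature.AlgebraicGeometry.Motives.projectiveSpace n k).left, ∃ U : (Literature.AlgebraicGeometry.Motives.projectiveSpace n k).left.affineOpens, y ∈ (U : (Literature.AlgebraicGeometry.Motives.projectiveSpace n k).left.Opens) ∧ (ι.ker.ideal U).IsPrincipal) → ∀ (h : H), ¬ IsRegularLocalRing (H.presheaf.stalk h) → ∃ (O : Type) (_ : CommRing O) (_ : IsDomain O) (_ : IsDiscreteValuationRing O) (_ : CharZero O) (π : O →+* k), Function.Surjective π ∧ (letI := MvPolynomial.gradedAlgebra (σ := Fin (n + 1)) (R := O); letI := MvPolynomial.gradedAlgebra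 (σ := Fin (n + 1)) (R := k); ∀ (φ : MvPolynomial.homogeneousSubmodule (Fin (n + 1)) O →+*ᵍ MvPolynomial.homogeneousSubmodule (Fin (n + 1)) k) (hφ' : HomogeneousIdeal.irrelevant (MvPolynomial.homogeneousSubmodule (Fin (n + 1)) k) ≤ (HomogeneousIdeal.irrelevant (MvPolynomial.homogeneousSubmodule (Fin (n + 1)) O)).map φ), (∀ s, φ s = MvPolynomial.map π s) → ∀ Y : Set (AlgebraicGeometry.Proj (MvPolynomial.homogeneousSubmodule (Fin (n + 1)) O)), Y = Set.range (CategoryTheory.CategoryStruct.comp ι (AlgebraicGeometry.Proj.map φ hφ') : H ⟶ (AlgebraicGeometry.Proj (MvPolynomial.homogeneousSubmodule (Fin (n + 1)) O))) → ∃ (P' : AlgebraicGeometry.Scheme.{0}) (σ : P' ⟶ (AlgebraicGeometry.Proj (MvPolynomial.homogeneousSubmodule (Fin (n + 1)) O))) (S' : Set P'), (∀ Q : (∀ X' : AlgebraicGeometry.Scheme.{0}, (X' ⟶ (AlgebraicGeometry.Proj (MvPolynomial.homogeneousSubmodule (Fin (n + 1)) O))) → Set X' → Prop), Q (AlgebraicGeometry.Proj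 (MvPolynomial.homogeneousSubmodule (Fin (n + 1)) O)) (CategoryTheory.CategoryStruct.id _) Y → (∀ (X' X'' : AlgebraicGeometry.Scheme.{0}) (σ' : X' ⟶ (AlgebraicGeometry.Proj (MvPolynomial.homogeneousSubmodule (Fin (n + 1)) O))) (Y' : Set X') (C : X'.IdealSheafData) (τ : X'' ⟶ X'), Q X' σ' Y' → Literature.AlgebraicGeometry.Resolution.IsBlowup τ C → Literature.AlgebraicGeometry.Resolution.Scheme.IsRegular C.subscheme → AlgebraicGeometry.Flat (CategoryTheory.CategoryStruct.comp C.subschemeι (CategoryTheory.CategoryStruct.comp σ' (CategoryTheory.CategoryStruct.comp (AlgebraicGeometry.Proj.toSpecZero (MvPolynomial.homogeneousSubmodule (Fin (n + 1)) O)) (AlgebraicGeometry.Spec.map (CommRingCat.ofHom (algebraMap O (MvPolynomial.homogeneousSubmodule (Fin (n + 1)) O 0))))))) → σ' '' (C.support : Set X') ⊆ {x | ¬ IsGenericPoint x Y} → (C.support : Set X') ∩ (CategoryTheory.CategoryStruct.comp σ' (CategoryTheory.CategoryStruct.comp (AlgebraicGeometry.Proj.toSpecZero (MvPolynomial.homogeneousSubmodule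 (Fin (n + 1)) O)) (AlgebraicGeometry.Spec.map (CommRingCat.ofHom (algebraMap O (MvPolynomial.homogeneousSubmodule (Fin (n + 1)) O 0)))))) ⁻¹' {IsLocalRing.closedPoint O} ⊆ Y' → ((CategoryTheory.CategoryStruct.comp ι (AlgebraicGeometry.Proj.map φ hφ') : H ⟶ (AlgebraicGeometry.Proj (MvPolynomial.homogeneousSubmodule (Fin (n + 1)) O))) h) ∉ σ' '' (C.support : Set X') → Q X'' (CategoryTheory.CategoryStruct.comp τ σ') (closure (τ ⁻¹' (Y' \ (C.support : Set X'))))) → Q P' σ S') ∧ ∃ C : P'.IdealSheafData, Literature.AlgebraicGeometry.Resolution.Scheme.IsRegular C.subscheme ∧ AlgebraicGeometry.Flat (CategoryTheory.CategoryStruct.comp C.subschemeι (CategoryTheory.CategoryStruct.comp σ (CategoryTheory.CategoryStruct.comp (AlgebraicGeometry.Proj.toSpecZero (MvPolynomial.homogeneousSubmodule (Fin (n + 1)) O)) (AlgebraicGeometry.Spec.map (CommRingCat.ofHom (algebraMap O (MvPolynomial.homogeneousSubmodule (Fin (n + 1)) O 0))))))) ∧ (∃ x' : P', x' ∈ (C.support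 : Set P') ∧ σ x' = ((CategoryTheory.CategoryStruct.comp ι (AlgebraicGeometry.Proj.map φ hφ') : H ⟶ (AlgebraicGeometry.Proj (MvPolynomial.homogeneousSubmodule (Fin (n + 1)) O))) h) ∧ ∃ c : P', c ∈ (C.support : Set P') ∧ c ∉ (CategoryTheory.CategoryStruct.comp σ (CategoryTheory.CategoryStruct.comp (AlgebraicGeometry.Proj.toSpecZero (MvPolynomial.homogeneousSubmodule (Fin (n + 1)) O)) (AlgebraicGeometry.Spec.map (CommRingCat.ofHom (algebraMap O (MvPolynomial.homogeneousSubmodule (Fin (n + 1)) O 0)))))) ⁻¹' {IsLocalRing.closedPoint O} ∧ c ⤳ x') ∧ (C.support : Set P') ∩ (CategoryTheory.CategoryStruct.comp σ (CategoryTheory.CategoryStruct.comp (AlgebraicGeometry.Proj.toSpecZero (MvPolynomial.homogeneousSubmodule (Fin (n + 1)) O)) (AlgebraicGeometry.Spec.map (CommRingCat.ofHom (algebraMap O (MvPolynomial.homogeneousSubmodule (Fin (n + 1)) O 0)))))) ⁻¹' {IsLocalRing.closedPoint O} ⊆ closure S' ∧ σ '' (C.support : Set P') ⊆ {x | ¬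 IsGenericPoint x Y})) :=
  Iff.rfl

/-- **[OURS · L1 W4.5(b)] `EquisingularLiftNat p → ULTFlat p`** — first touch after a HORIZONTAL avoiding chain with a GLOBALLY
`O`-flat touching centre (`Sections.ultFlat_of_equisingularLiftNat`, `…NatUltFlat.lean`; engines p500156 / p503337 / p504712 /
p509967). [folklore] -/
theorem ultFlat_of_equisingularLiftNat {p : ℕ} (hE : EquisingularLiftNat p) : ULTFlat p :=
  Summit.ResolutionOfSingularities.ResolutionOfSingularities.Cruxes.EquisingularLiftNat.Sections.ultFlat_of_equisingularLiftNat hE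

/-- **THE DISPROVER'S EXIT (flat currency).** ONE instance `(k, n, H, ι, h)` with `𝒪_{H,h}` not regular and `¬ ULTFlatAt p k n H ι h`
refutes the item `EquisingularLiftNat p`. [folklore] -/
theorem not_equisingularLiftNat_of_not_ultFlatAt {p : ℕ} (hp : p.Prime) {k : Type} [Field k] [CharP k p]
    [IsAlgClosed k] {n : ℕ} {H : AlgebraicGeometry.Scheme.{0}}
    {ι : H ⟶ (Literature.AlgebraicGeometry.Motives.projectiveSpace n k).left}
    (hι : AlgebraicGeometry.IsClosedImmersion ι) (hH : AlgebraicGeometry.IsIntegral H)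
    (hloc : ∀ y : (Literature.AlgebraicGeometry.Motives.projectiveSpace n k).left,
      ∃ U : (Literature.AlgebraicGeometry.Motives.projectiveSpace n k).left.affineOpens,
        y ∈ (U : (Literature.AlgebraicGeometry.Motives.projectiveSpace n k).left.Opens) ∧ (ι.ker.ideal U).IsPrincipal)
    {h : H} (h1 : ¬ IsRegularLocalRing (H.presheaf.stalk h)) (hno : ¬ ULTFlatAt p k n H ι h) :
    ¬ EquisingularLiftNat p :=
  fun hE => hno (ultFlat_of_equisingularLiftNat hE hp k n H ι hι hH hloc h h1)

/-- Pure logic: the flat form implies o1's `ULTAt` (the inductive closure under the flat avoiding steps is contained in the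
closure under all avoiding steps; the flatness conjunct of the centre is dropped). [folklore] -/
theorem ultAt_of_ultFlatAt {p : ℕ} {k : Type} [Field k] [CharP k p] [IsAlgClosed k] {n : ℕ} {H : AlgebraicGeometry.Scheme.{0}}
    {ι : H ⟶ (Literature.AlgebraicGeometry.Motives.projectiveSpace n k).left} {h : H} (hF : ULTFlatAt p k n H ι h) :
    ULTAt p k n H ι h := by
  obtain ⟨O, i1, i2, i3, i4, π, hπ, h'⟩ := hF
  refine ⟨O, i1, i2, i3, i4, π, hπ, ?_⟩
  letI := MvPolynomial.gradedAlgebra (σ := Fin (n + 1)) (R := O)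
  letI := MvPolynomial.gradedAlgebra (σ := Fin (n + 1)) (R := k)
  intro φ hφ' hφ Y hY
  obtain ⟨P', σ, S', hav, C, hC, -, hx', hE1, hgen⟩ := h' φ hφ' hφ Y hY
  exact ⟨P', σ, S', fun Q h0 hs => hav Q h0 (fun X' X'' σ' Y' C' τ hQ hbl hC' _ hg hE hxc =>
    hs X' X'' σ' Y' C' τ hQ hbl hC' hg hE hxc), C, hC, hx', hE1, hgen⟩

end EquisingularLift

end Summit.ResolutionOfSingularities.ResolutionOfSingularities.Theorems

end
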